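import Mathlib
import HarnessLib
import Literature.NumberTheory.LFunctions.ZetaSubconvexityRobertSargos
import Literature.NumberTheory.LFunctions.RobertSargosFourthDerivativeProofs
import Literature.NumberTheory.LFunctions.BourgainTheorem4LogFrontier

/-!
# Bourgain's (5.1) for `F = log` and Theorem 5: the frontier after the discharge of the
# Robert–Sargos test

Topic `Literature/NumberTheory/LFunctions`. Composition theorems recording what the discharge of
the named facts `Literature.NumberTheory.LFunctions.Bourgain2017_eq51_log` (J. Bourgain,
*Decoupling, exponential sums and the Riemann zeta function*, J. Amer. Math. Soc. **30** (2017),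
§5, eq. (5.1) for `F = log`: `|∑_{M/2 ≤ m ≤ M} e(T log(m/M))| ≪ M^{1/2} T^{13/84+ε}` for
`1 ≤ M ≤ √T`) and `Literature.NumberTheory.LFunctions.bourgain_subconvexity` (Theorem 5,
`|ζ(1/2 + it)| ≪ t^{13/84+ε}`) rests on, now that

* the Robert–Sargos fourth-derivative test is a theorem of this tree
  (`Literature.NumberTheory.LFunctions.Sargos2003_lemma4_holds`, `RobertSargosFourthDerivativeProofs.lean`),
  which covers (3.19) on `M ≤ T^{17/42}` exactly
  (`Literature.NumberTheory.LFunctions.Bourgain2017_eq51_log_of_theorem4_of_sargos`,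
  `ZetaSubconvexityRobertSargos.lean`), and
* Bourgain's Theorem 4 for `F = log` (`Literature.NumberTheory.LFunctions.Bourgain2017_theorem4_log`,
  (3.19) on `T^{17/42} ≤ M ≤ √T`) has been reduced to Corollary 3 (2.28) and the two lower cases of
  (3.18) (`Literature.NumberTheory.LFunctions.Bourgain2017_theorem4_log_of_corollary3_of_eq318`,
  `BourgainTheorem4LogFrontier.lean`: the Huxley–Watt part (3.4)–(3.13) being proved in
  `ZetaSumEq312.lean`, the optimisation (3.12) ⇒ (3.13), (3.16) ⇒ (3.18) in
  `BourgainTheorem4Optimisation.lean`, step 6 in `BourgainTheorem4.lean`).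

Consequently:

* `Literature.NumberTheory.LFunctions.Bourgain2017_eq51_log_of_theorem4_log` — (5.1) for `F = log`
  from Theorem 4 ALONE;
* `Literature.NumberTheory.LFunctions.bourgain_subconvexity_of_theorem4_log` — Theorem 5 from
  Theorem 4 alone ((4.3) is `Literature.NumberTheory.LFunctions.Bourgain2017_eq43_holds`);
* `Literature.NumberTheory.LFunctions.Bourgain2017_eq51_log_of_corollary3_of_eq318`,
  `Literature.NumberTheory.LFunctions.bourgain_subconvexity_of_corollary3_of_eq318` — (5.1) and
  Theorem 5 from exactly two displayed inputs of the paper, written out as explicit hypotheses: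
  Corollary 3 (2.28) (the paper's `ℓ²`-decoupling theorem, §§2–3) and the cases
  `T^{5/12} ≤ M ≤ T^{49/114}`, `2T^{1/3} ≤ M < T^{5/12}` of (3.18) (Huxley's resonance-curve
  treatment of the second spacing problem, [H1] §7, through (3.14)–(3.17); only
  `T^{17/42} ≤ M < T^{3/7}` is used);
* `Literature.NumberTheory.LFunctions.Bourgain2017_eq51_log_of_eq210_of_eq318` — the same with
  Corollary 3 replaced by the decoupling bound (2.10) for the curves `(t, t², φ₃, φ₄)` of (2.11)
  (`Literature.NumberTheory.LFunctions.Bourgain2017_corollary3_of_eq210`, `BourgainBilinearReduction.lean`).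

No definition and no named fact is introduced; every declaration is a composition of theorems of
the tree. (The alternative route to the lower cases of (3.18) through the hypotheses (3.4), (3.15)
on the Huxley–Watt vectors is `Literature.NumberTheory.LFunctions.Bourgain2017_eq316_log_of_reduction`,
`BourgainTheorem4Assembly.lean`.)

## References

* J. Bourgain, *Decoupling, exponential sums and the Riemann zeta function*, J. Amer. Math. Soc.
  30 (2017), 205–224, doi:10.1090/jams/860, arXiv:1408.5794 — Theorem 4 (3.19), Theorem 5,
  §5 (5.1), Corollary 3 (2.28), (2.10)–(2.11), §4 (3.18). [cite: BourgainJAMS2017, §5 eq. (5.1); Theorems 4, 5]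
* O. Robert, P. Sargos, *A fourth derivative test for exponential sums*, Compositio Math. 130
  (2002), 275–292 — Theorem 1; P. Sargos, Acta Arith. 110 (2003), Lemma 4.
* M. N. Huxley, *Exponential sums and the Riemann zeta function IV*, Proc. London Math. Soc. (3)
  66 (1993), 1–40 — §7 (the source of (3.15), hence of the lower cases of (3.18)).
-/

noncomputable section

open Complex MeasureTheory Finset
open scoped Real

namespace Literature.NumberTheory.LFunctions

/-- **(5.1) for `F = log` from Theorem 4 alone**: the Robert–Sargos test
(`Sargos2003_lemma4_holds`) covers `M ≤ T^{17/42}`, Theorem 4 the rest.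
[cite: BourgainJAMS2017, §5 eq. (5.1); Theorem 4, eq. (3.19)] -/
theorem Bourgain2017_eq51_log_of_theorem4_log (h4 : Bourgain2017_theorem4_log) :
    Bourgain2017_eq51_log :=
  Bourgain2017_eq51_log_of_theorem4_of_sargos h4 Sargos2003_lemma4_holds

/-- **Theorem 5 from Theorem 4 alone** (`|ζ(1/2 + it)| ≪ t^{13/84+ε}`): (4.3) is
`Bourgain2017_eq43_holds`, the range `M ≤ T^{17/42}` is the Robert–Sargos test
`Sargos2003_lemma4_holds`. [cite: BourgainJAMS2017, Theorem 5] -/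
theorem bourgain_subconvexity_of_theorem4_log (h4 : Bourgain2017_theorem4_log) :
    bourgain_subconvexity :=
  bourgain_subconvexity_of_theorem4_of_sargos h4 Sargos2003_lemma4_holds

/-- **(5.1) for `F = log` from Corollary 3 (2.28) and the lower cases of (3.18).** The two
hypotheses are written out exactly as in
`Literature.NumberTheory.LFunctions.Bourgain2017_theorem4_log_of_corollary3_of_eq318`: `hC3` is the
mean value bound `A₆(N; δ, Δ) ≤ C(ε) δΔN^{9+ε}` (`N ≥ 1`, `1/N² ≤ δ ≤ 1`, `1/N ≤ Δ ≤ 1`) for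
`Literature.NumberTheory.LFunctions.bourgainA6`, and `h318` the bounds `|S|⁶ ≤ C M^{4+ε}T^{1/2}` on
`[T^{5/12}, T^{49/114}]`, `|S|⁶ ≤ C M^{2+ε}T^{4/3}` on `[2T^{1/3}, T^{5/12})` for `T ≥ T₀`.
[cite: BourgainJAMS2017, §5 eq. (5.1); Corollary 3 (2.28); §4 (3.18)] -/
theorem Bourgain2017_eq51_log_of_corollary3_of_eq318
    (hC3 : ∀ ε : ℝ, 0 < ε → ∃ C : ℝ, ∀ N : ℕ, 1 ≤ N → ∀ δ Δ : ℝ,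
      1 / (N : ℝ) ^ 2 ≤ δ → δ ≤ 1 → 1 / (N : ℝ) ≤ Δ → Δ ≤ 1 →
        bourgainA6 N δ Δ ≤ C * δ * Δ * (N : ℝ) ^ (9 + ε))
    (h318 : ∀ ε : ℝ, 0 < ε → ∃ C T₀ : ℝ, ∀ T : ℝ, T₀ ≤ T → ∀ M : ℝ,
      (T ^ (5 / 12 : ℝ) ≤ M → M ≤ T ^ (49 / 114 : ℝ) →
          ‖bourgainSum Real.log T M‖ ^ 6 ≤ C * M ^ (4 + ε) * T ^ (1 / 2 : ℝ)) ∧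
      (2 * T ^ (1 / 3 : ℝ) ≤ M → M < T ^ (5 / 12 : ℝ) →
          ‖bourgainSum Real.log T M‖ ^ 6 ≤ C * M ^ (2 + ε) * T ^ (4 / 3 : ℝ))) :
    Bourgain2017_eq51_log :=
  Bourgain2017_eq51_log_of_theorem4_log (Bourgain2017_theorem4_log_of_corollary3_of_eq318 hC3 h318)

/-- **Theorem 5 from Corollary 3 (2.28) and the lower cases of (3.18)** (hypotheses as in
`Bourgain2017_eq51_log_of_corollary3_of_eq318`). [cite: BourgainJAMS2017, Theorem 5; Corollary 3
(2.28); §4 (3.18)] -/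
theorem bourgain_subconvexity_of_corollary3_of_eq318
    (hC3 : ∀ ε : ℝ, 0 < ε → ∃ C : ℝ, ∀ N : ℕ, 1 ≤ N → ∀ δ Δ : ℝ,
      1 / (N : ℝ) ^ 2 ≤ δ → δ ≤ 1 → 1 / (N : ℝ) ≤ Δ → Δ ≤ 1 →
        bourgainA6 N δ Δ ≤ C * δ * Δ * (N : ℝ) ^ (9 + ε))
    (h318 : ∀ ε : ℝ, 0 < ε → ∃ C T₀ : ℝ, ∀ T : ℝ, T₀ ≤ T → ∀ M : ℝ,
      (T ^ (5 / 12 : ℝ) ≤ M → M ≤ T ^ (49 / 114 : ℝ) →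
          ‖bourgainSum Real.log T M‖ ^ 6 ≤ C * M ^ (4 + ε) * T ^ (1 / 2 : ℝ)) ∧
      (2 * T ^ (1 / 3 : ℝ) ≤ M → M < T ^ (5 / 12 : ℝ) →
          ‖bourgainSum Real.log T M‖ ^ 6 ≤ C * M ^ (2 + ε) * T ^ (4 / 3 : ℝ))) :
    bourgain_subconvexity :=
  bourgain_subconvexity_of_theorem4_log (Bourgain2017_theorem4_log_of_corollary3_of_eq318 hC3 h318)

/-- **(5.1) for `F = log` from the decoupling bound (2.10) and the lower cases of (3.18)**
(`h210` written out exactly as in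
`Literature.NumberTheory.LFunctions.Bourgain2017_theorem4_log_of_eq210_of_eq318`).
[cite: BourgainJAMS2017, §5 eq. (5.1); eqs. (2.10)–(2.11); §4 (3.18)] -/
theorem Bourgain2017_eq51_log_of_eq210_of_eq318
    (h210 : ∀ ε c B : ℝ, 0 < ε → 0 < c → ∃ C : ℝ,
      ∀ (φ₃ φ₃₁ φ₃₂ φ₃₃ φ₃₄ φ₃₅ φ₄ φ₄₁ φ₄₂ φ₄₃ φ₄₄ φ₄₅ : ℝ → ℝ),
        (∀ t ∈ Set.Icc (0 : ℝ) 1,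
          HasDerivAt φ₃ (φ₃₁ t) t ∧ HasDerivAt φ₃₁ (φ₃₂ t) t ∧ HasDerivAt φ₃₂ (φ₃₃ t) t ∧
            HasDerivAt φ₃₃ (φ₃₄ t) t ∧ HasDerivAt φ₃₄ (φ₃₅ t) t ∧
          HasDerivAt φ₄ (φ₄₁ t) t ∧ HasDerivAt φ₄₁ (φ₄₂ t) t ∧ HasDerivAt φ₄₂ (φ₄₃ t) t ∧
            HasDerivAt φ₄₃ (φ₄₄ t) t ∧ HasDerivAt φ₄₄ (φ₄₅ t) t) →
        (∀ t ∈ Set.Icc (0 : ℝ) 1,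
          |φ₃ t| ≤ B ∧ |φ₃₁ t| ≤ B ∧ |φ₃₂ t| ≤ B ∧ |φ₃₃ t| ≤ B ∧ |φ₃₄ t| ≤ B ∧ |φ₃₅ t| ≤ B ∧
          |φ₄ t| ≤ B ∧ |φ₄₁ t| ≤ B ∧ |φ₄₂ t| ≤ B ∧ |φ₄₃ t| ≤ B ∧ |φ₄₄ t| ≤ B ∧ |φ₄₅ t| ≤ B) →
        (∀ t ∈ Set.Icc (0 : ℝ) 1, c ≤ |φ₃₃ t|) →
        (∀ s ∈ Set.Icc (0 : ℝ) 1, ∀ t ∈ Set.Icc (0 : ℝ) 1,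
          c ≤ |φ₃₃ s * φ₄₄ t - φ₄₃ s * φ₃₄ t|) →
        ∀ M : ℕ, 1 ≤ M → ∀ a b a' b' : ℕ, a ≤ b → b < a' → a' ≤ b' → b' ≤ M →
          (M : ℝ) ≤ 4 * ((a' : ℝ) - b) → ∀ c₀ c₀' : ℝ,
          (∫ y in Set.Icc ![0, 0, c₀, c₀'] ![1, 1, c₀ + (M : ℝ) ^ 2, c₀' + M],
            ‖∑ m ∈ Finset.Icc a b, Complex.exp (2 * ↑π * I *
                ↑((m : ℝ) * y 0 + (m : ℝ) ^ 2 * y 1 + φ₃ ((m : ℝ) / M) * y 2 + φ₄ ((m : ℝ) / M) * y 3))‖ ^ 6 *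
              ‖∑ m ∈ Finset.Icc a' b', Complex.exp (2 * ↑π * I *
                ↑((m : ℝ) * y 0 + (m : ℝ) ^ 2 * y 1 + φ₃ ((m : ℝ) / M) * y 2 + φ₄ ((m : ℝ) / M) * y 3))‖ ^ 6) ≤
            C * (M : ℝ) ^ (9 + ε))
    (h318 : ∀ ε : ℝ, 0 < ε → ∃ C T₀ : ℝ, ∀ T : ℝ, T₀ ≤ T → ∀ M : ℝ,
      (T ^ (5 / 12 : ℝ) ≤ M → M ≤ T ^ (49 / 114 : ℝ) →
          ‖bourgainSum Real.log T M‖ ^ 6 ≤ C * M ^ (4 + ε) * T ^ (1 / 2 : ℝ)) ∧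
      (2 * T ^ (1 / 3 : ℝ) ≤ M → M < T ^ (5 / 12 : ℝ) →
          ‖bourgainSum Real.log T M‖ ^ 6 ≤ C * M ^ (2 + ε) * T ^ (4 / 3 : ℝ))) :
    Bourgain2017_eq51_log :=
  Bourgain2017_eq51_log_of_theorem4_log (Bourgain2017_theorem4_log_of_eq210_of_eq318 h210 h318)

end Literature.NumberTheory.LFunctions
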